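/-
Copyright (c) 2026 the pub-hodgecm-mathlib formalisation cell (harness21).  Prover seat hodgecm-mathlib-K2E3-p21 (g5), Track B «K2-LIT» ∕ h413
(`stmt-HodgeConjecture-24833`), line `K2_E3_EllipticInputs`, unit U12 §L, road «GL-[M6]-sc» (line lead K2E3-p23 (g5), RULINGS #10 (M10-1) «B4-J need only export the
maximal-parabolic radicals' cusp forms (+ opposite)»), brick B4-J, FILE 4: «GENERAL BLOCK LABELS AND THE OPPOSITE RADICALS».  2026-09-04.
-/
import Summits.HodgeConjecture.HodgeConjecture.Theorems.K2E3GL3SupercuspidalJacquetVanishing   -- ★ FILE 3 p858072 (this seat): heads for `c : Fin n → Fin r` monotone; brings ★ FILES 1–2, ★ `weylLong`, ★ `permGL`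
import HarnessLib

/-!
# K2_E3 road (h413), road «GL-[M6]-sc», brick B4-J (file 4): the cusp-form property of supercuspidal coefficients of `GL_n(F)` along the unipotent radical `U_c` for an
# ARBITRARY finite linear order of block labels (`c : Fin n → α`, e.g. `Bool`), and along the OPPOSITE radicals `U_{c ∘ rev} = w₀ U_c w₀⁻¹`

Cell `pub/hodgecm-mathlib` (D-0151), Track B, seat K2E3-p21 (g5); line lead K2E3-p23 (g5), dealer K2E3-plan (g3).  `--supports stmt-HodgeConjecture-24833 --as helper`; THEOREMS
ONLY (no definition ∕ instance ∕ notation ∕ named-fact hypothesis ∕ `sorry`).  PURPOSE: the consumer ★ B4-E1 `K2E3GL3CuspFormCancellationMaxParabolic` (K2E5-p17 (g4)) eats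
`hcusp : ∀ x y, ∫ u : ↥(unipotentRadicalGL F (![false, false, true] : Fin 3 → Bool)), θ (x * ↑u * y) ∂ν = 0` and the same on the OPPOSITE radical
`↥(unipotentRadicalGL F ![true, true, false])`; ★ FILE 3 delivers `Fin r`-valued MONOTONE labels.  This file closes both currency gaps:
* §1 GENERIC TRANSPORT `integral_translate_eq_zero_of_continuousMulEquiv`: if `e : ↥H₁ ≃ₜ* ↥H₂` is conjugation by `w` (`↑(e u) = w u w⁻¹`) and `θ` is two-sidedly
  `H₁`-cuspidal for EVERY Haar measure of `H₁`, then `θ` is two-sidedly `H₂`-cuspidal for every Haar measure of `H₂` (push the measure along `e⁻¹`, absorb `w` in `x, y`).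
* §2 GENERAL LABELS: `unipotentRadicalGL_minBlock_le` ∕ `isProperBlocks_minBlock` (coarsening a proper labelling `c : Fin n → α` at its minimal block to a proper
  two-block `Fin 2`-labelling with `U_{c₂} ⊆ U_c`), whence **`coinvariants_subsingleton_restrictUnipotentGL_of_isSupercuspidal'`** (HC's criterion ⇒ for ANY proper
  `c : Fin n → α`, `α` a finite linear order), `forall_mem_span_unipotentRadicalGL_of_isSupercuspidal'`, and the ★ FILE 3 `GL_n(F)` cusp-form heads VERBATIM for general
  `α` + `Monotone c`, in the matrix-coefficient currency `π.matrixCoeff φ v (x u y)` (★ `matrixCoeff_apply`: `= φ (π (x u y) v)` by `rfl`):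
  **`integral_matrixCoeff_translate_unipotentRadicalGL_eq_zero`**, **`integral_matrixCoeff_sesqForm_translate_unipotentRadicalGL_eq_zero`** (any Haar `ν`).
* §3 OPPOSITE RADICALS: `coe_weylLong_conj_apply` (`(w₀ g w₀⁻¹)ᵢⱼ = g_{rev i, rev j}`), **`exists_continuousMulEquiv_unipotentRadicalGL_conj_weylLong (c₁ c₂ : Fin n → α)
  (hrev : ∀ i, c₂ i = c₁ (Fin.rev i)) : ∃ e : ↥U_{c₁} ≃ₜ* ↥U_{c₂}, ∀ u, ↑(e u) = w₀ * ↑u * w₀⁻¹`**, and the heads along `U_{c₂}` for `c₁` monotone proper: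
  **`integral_sesqForm_apply_translate_unipotentRadicalGL_opposite_eq_zero`** (any Haar `ν` on `↥U_{c₂}`), plus the `G_Λ`-pull-back readings for the road's `θ̃ = θ ∘ π_Λ`
  (★ FILE 3 `isSupercuspidal_comp_mk'_quotScalar`): `…_comp_mk_eq_zero'` (general `α`) and `…_opposite_comp_mk_eq_zero`.  At `GL₃`: `c₂ = ![true, true, false]` from
  `c₁ = ![false, true, true]`, `c₂ = ![true, false, false]` from `c₁ = ![false, false, true]`, `c₂ = Fin.rev` (lower unitriangular) from `c₁ = id`.

THE MATHEMATICS [HarishChandra1970, Part I §3 p. 9; Part VII §2–§3]; [Casselman1995, Thm. 5.3.1, Prop. 1.4.4]; [BernsteinZelevinsky1976, Thm. 3.21]: the cusp condition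
`∫_N f(x n y) dn = 0` for ALL proper parabolics, standard or not, follows from the standard ones by conjugation; `w₀ P_c w₀⁻¹` is the OPPOSITE of `P_{c ∘ rev}`.

HONEST LABEL: HC_CM is proved only modulo the 7 printed citations (2 remaining named inputs: hLiu418 = `stmt-HodgeConjecture-24832`, h413 = `stmt-HodgeConjecture-24833`)
until rung 0 closes; this file is a count-neutral helper and closes no socket.

## References
* [HarishChandra1970] Harish-Chandra (notes by G. van Dijk), *Harmonic Analysis on Reductive p-adic Groups*, LNM 162 (1970), Part I §3 p. 9; Part VII §§2–3.
* [Casselman1995] W. Casselman, *Introduction to the theory of admissible representations of `p`-adic reductive groups* (1995 notes), Prop. 1.4.4, Thm. 5.3.1.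
* [BernsteinZelevinsky1976] I. N. Bernstein, A. V. Zelevinsky, *Representations of the group GL(n, F) where F is a non-archimedean local field*, Russian Math.
  Surveys 31:3 (1976), Thm. 3.21.
* [Rogawski1990] J. D. Rogawski, *Automorphic Representations of Unitary Groups in Three Variables*, Ann. of Math. Stud. 123 (1990), §4.13 p. 70, §12.2 p. 173.
-/

set_option autoImplicit false
-- the mandated namespace repeats the single-problem summit's segment (`HodgeConjecture.HodgeConjecture`)
set_option linter.dupNamespace false

noncomputable section

open Set Filter Topology MeasureTheory
open scoped MatrixGroups Pointwise ComplexConjugate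
open Literature.NumberTheory.Automorphic Literature.NumberTheory.GaloisRepresentations Literature.NumberTheory.GaloisRepresentations.IsNonarchimedeanLocalField
open Summit.HodgeConjecture.HodgeConjecture.Cruxes.H413.K2E3GLnUnipotentModScalars
open Summit.HodgeConjecture.HodgeConjecture.Cruxes.H413.K2E3GLnUnipotentExhaustion
open Summit.HodgeConjecture.HodgeConjecture.Cruxes.H413.K2E3GL3SupercuspidalJacquetVanishing
open Summit.HodgeConjecture.HodgeConjecture.Cruxes.H413.K2E1SupercuspidalCoefficientNCuspidal

namespace Summit.HodgeConjecture.HodgeConjecture.Cruxes.H413.K2E3GL3SupercuspidalCuspFormOppositeRadicals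

/-! ## §1  Generic transport of the two-sided cusp condition along a conjugation isomorphism of subgroups -/

section Transport

variable {G : Type*} [Group G] [TopologicalSpace G] [IsTopologicalGroup G] (H₁ H₂ : Subgroup G)
  [MeasurableSpace ↥H₁] [BorelSpace ↥H₁] [MeasurableSpace ↥H₂] [BorelSpace ↥H₂] {E : Type*} [NormedAddCommGroup E] [NormedSpace ℝ E]

/-- **TRANSPORT OF THE CUSP CONDITION ALONG `e : H₁ ≃ₜ* H₂`, `e(u) = w u w⁻¹`.**  If `∫_{H₁} θ(x u y) dν₁(u) = 0` for every Haar measure `ν₁` of `H₁` and all `x, y`,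
then `∫_{H₂} θ(x v y) dν₂(v) = 0` for every Haar measure `ν₂` of `H₂` and all `x, y`: `ν₂ = e_*(e⁻¹_* ν₂)` with `e⁻¹_* ν₂` Haar, and `x (w u w⁻¹) y = (x w) u (w⁻¹ y)`.
Covers conjugate subgroups (`H₂ = w H₁ w⁻¹`) and equal subgroups written differently (`w = 1`). [cite: HarishChandra1970, Part I §3 p. 9] [cite: Rogawski1990, §4.13 p. 70] -/
theorem integral_translate_eq_zero_of_continuousMulEquiv (w : G) (e : ↥H₁ ≃ₜ* ↥H₂) (he : ∀ u : ↥H₁, ((e u : ↥H₂) : G) = w * (u : G) * w⁻¹)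
    (θ : G → E) (h₁ : ∀ (ν₁ : Measure ↥H₁), ν₁.IsHaarMeasure → ∀ x y : G, ∫ u, θ (x * (u : G) * y) ∂ν₁ = 0)
    (ν₂ : Measure ↥H₂) [ν₂.IsHaarMeasure] (x y : G) : ∫ v, θ (x * (v : G) * y) ∂ν₂ = 0 := by
  haveI : (ν₂.map e.symm).IsHaarMeasure := e.symm.isHaarMeasure_map ν₂
  have hme : Measurable (e : ↥H₁ → ↥H₂) := e.continuous.measurable
  have hms : Measurable (e.symm : ↥H₂ → ↥H₁) := e.symm.continuous.measurable
  have hmap : (ν₂.map e.symm).map e = ν₂ := by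
    rw [Measure.map_map hme hms]
    have hid : ((e : ↥H₁ → ↥H₂) ∘ (e.symm : ↥H₂ → ↥H₁)) = id := funext fun v => e.apply_symm_apply v
    rw [hid, Measure.map_id]
  calc ∫ v, θ (x * (v : G) * y) ∂ν₂ = ∫ v, θ (x * (v : G) * y) ∂((ν₂.map e.symm).map e) := by rw [hmap]
    _ = ∫ u, θ (x * ((e u : ↥H₂) : G) * y) ∂(ν₂.map e.symm) := e.toHomeomorph.measurableEmbedding.integral_map _
    _ = ∫ u, θ ((x * w) * (u : G) * (w⁻¹ * y)) ∂(ν₂.map e.symm) := by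
        refine integral_congr_ae (Filter.Eventually.of_forall fun u => ?_)
        simp only [he]
        congr 1
        group
    _ = 0 := h₁ _ inferInstance (x * w) (w⁻¹ * y)

end Transport

/-! ## §2  `GL_n(F)`: general block labels `c : Fin n → α` -/

section Labels

variable {F : Type*} [Field F] [ValuativeRel F] [TopologicalSpace F] [IsNonarchimedeanLocalField F] {n : ℕ}
  {V : Type*} [AddCommGroup V] [Module ℂ V] (π : Representation ℂ (GL (Fin n) F) V) {α : Type*} [LinearOrder α] [Fintype α]

omit [ValuativeRel F] [TopologicalSpace F] [IsNonarchimedeanLocalField F] [Fintype α] in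
/-- **Coarsening at the minimal block**: for `m` minimal, the two-block labelling `c₂ = 1_{c ≠ m}` has `U_{c₂} ≤ U_c` (`c₂` is a monotone function of `c`). [cite: Casselman1995, Thm. 5.3.1] -/
theorem unipotentRadicalGL_minBlock_le (c : Fin n → α) (m : α) (hm : ∀ a, m ≤ a) :
    unipotentRadicalGL F (fun i => if c i = m then (0 : Fin 2) else 1) ≤ unipotentRadicalGL F c := by
  intro g hg
  rw [mem_unipotentRadicalGL_iff_apply] at hg ⊢
  intro i j hij
  refine hg i j ?_
  by_cases hi : c i = m
  · have hj : c j = m := le_antisymm (hi ▸ hij) (hm _)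
    simp [hi, hj]
  · by_cases hj : c j = m
    · simp [hi, hj]
    · simp [hi, hj]

omit [ValuativeRel F] [TopologicalSpace F] [IsNonarchimedeanLocalField F] [Fintype α] in
/-- The coarsening at any attained block of a proper labelling is proper (two non-empty blocks). [cite: Casselman1995, Thm. 5.3.1] -/
theorem isProperBlocks_minBlock {c : Fin n → α} (hc : IsProperBlocks c) (m : α) :
    IsProperBlocks (fun i => if c i = m then (0 : Fin 2) else 1) := by
  haveI : Nontrivial α := hc.2
  refine ⟨fun x => ?_, inferInstance⟩
  obtain ⟨a, ha⟩ := exists_ne m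
  rcases Fin.exists_fin_two.1 ⟨x, rfl⟩ with rfl | rfl
  · obtain ⟨i, hi⟩ := hc.1 m
    exact ⟨i, by simp [hi]⟩
  · obtain ⟨i, hi⟩ := hc.1 a
    exact ⟨i, by simp [hi, ha]⟩

/-- **HARISH-CHANDRA'S CRITERION ⇒ FOR `GL_n(F)`, ANY FINITE LINEAR ORDER OF BLOCK LABELS** (e.g. `c : Fin n → Bool`): `π` smooth supercuspidal, `c` proper ⇒ the Jacquet module
`V ⧸ V(U_c)` vanishes (★ `coinvariantsKer_eq_top_of_isSupercuspidal` for the coarsening at the minimal block + ★ `coinvariantsKer_mono`).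
[cite: Casselman1995, Thm. 5.3.1] [cite: BernsteinZelevinsky1976, Thm. 3.21] [cite: HarishChandra1970, Part I §3 p. 9] -/
theorem coinvariants_subsingleton_restrictUnipotentGL_of_isSupercuspidal' (hπ : π.IsSmooth) (hsc : π.IsSupercuspidal) {c : Fin n → α} (hc : IsProperBlocks c) :
    Subsingleton (Representation.restrictUnipotentGL F c π).Coinvariants := by
  haveI : Nontrivial α := hc.2
  have hmin : ∀ a, (Finset.univ : Finset α).min' Finset.univ_nonempty ≤ a := fun a => Finset.min'_le _ _ (Finset.mem_univ a)
  change Subsingleton (V ⧸ _)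
  rw [Submodule.Quotient.subsingleton_iff]
  have h2 := coinvariantsKer_eq_top_of_isSupercuspidal π hπ hsc (isProperBlocks_minBlock hc ((Finset.univ : Finset α).min' Finset.univ_nonempty))
  exact eq_top_iff.2 (h2 ▸ coinvariantsKer_mono π (unipotentRadicalGL_minBlock_le (F := F) c _ hmin))

/-- **`V = V(U_c)`**, span currency, general labels. [cite: Casselman1995, Thm. 5.3.1] [cite: BernsteinZelevinsky1976, Thm. 3.21] -/
theorem forall_mem_span_unipotentRadicalGL_of_isSupercuspidal' (hπ : π.IsSmooth) (hsc : π.IsSupercuspidal) {c : Fin n → α} (hc : IsProperBlocks c) (w : V) :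
    w ∈ Submodule.span ℂ (Set.range fun p : ↥(unipotentRadicalGL F c) × V => π (p.1 : GL (Fin n) F) p.2 - p.2) := by
  haveI := coinvariants_subsingleton_restrictUnipotentGL_of_isSupercuspidal' π hπ hsc hc
  have h0 : Representation.Coinvariants.mk (Representation.restrictUnipotentGL F c π) w = 0 := Subsingleton.elim _ _
  rw [Representation.Coinvariants.mk_eq_zero] at h0
  -- the generators of `ker (restrictUnipotentGL F c π)` are among ours (`U_c = map subtype U_c^P`)
  refine (Submodule.span_le.2 ?_) h0
  rintro _ ⟨⟨q, v⟩, rfl⟩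
  exact Submodule.subset_span ⟨(⟨(q : ↥(standardParabolicGL F c)), Subgroup.mem_map_of_mem _ q.2⟩, v), rfl⟩

variable [NeZero n] {c : Fin n → α} [MeasurableSpace ↥(unipotentRadicalGL F c)] [BorelSpace ↥(unipotentRadicalGL F c)] (μ : Measure ↥(unipotentRadicalGL F c))

/-- **CUSP-FORM PROPERTY ALONG `U_c`, GENERAL LABELS, matrix-coefficient currency**: `∫_{U_c} c_{φ,v}(x u y) dμ(u) = 0` for all `x, y ∈ GL_n(F)` (`π` smooth
supercuspidal, `φ ∈ π̃`, `c` proper monotone, `μ` right-invariant finite on compacta; `c_{φ,v} = π.matrixCoeff φ v`, ★ `matrixCoeff_apply`) — ★ FILE 3's head with a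
general finite linear order `α` of labels for `Fin r`. [cite: HarishChandra1970, Part I §3 p. 9] [cite: Casselman1995, Thm. 5.3.1] -/
theorem integral_matrixCoeff_translate_unipotentRadicalGL_eq_zero (hπ : π.IsSmooth) (hsc : π.IsSupercuspidal) (hc : IsProperBlocks c) (hcm : Monotone c)
    [IsFiniteMeasureOnCompacts μ] [μ.IsMulRightInvariant] {φ : Module.Dual ℂ V} (hφ : φ ∈ π.contragredient) (v : V) (x y : GL (Fin n) F) :
    ∫ u, π.matrixCoeff φ v (x * (u : GL (Fin n) F) * y) ∂μ = 0 := by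
  haveI : T2Space F := (isLocalField F).toT2Space
  obtain ⟨Nj, hmono, hcpt, ho, hex⟩ := exists_compactOpen_subgroups_unipotentRadicalGL (F := F) c hcm
  obtain ⟨C, hC, hsupp⟩ := hsc φ hφ v
  have hcs : HasCompactSupport fun u : ↥(unipotentRadicalGL F c) => φ (π (x * (u : GL (Fin n) F) * y) v) :=
    hasCompactSupport_comp_translate_of_support_subset_mul_center (unipotentRadicalGL_le_upperUnitriangular c hcm) (isClosed_unipotentRadicalGL c)
      (θ := π.matrixCoeff φ v) hC hsupp x y
  have hcont : Continuous fun u : ↥(unipotentRadicalGL F c) => φ (π (x * (u : GL (Fin n) F) * y) v) := by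
    refine (isLocallyConstant_dual_apply_mul_subgroup π (unipotentRadicalGL F c) hπ φ x (π y v)).continuous.congr fun u => ?_
    rw [← Module.End.mul_apply, ← map_mul]
  simp only [Representation.matrixCoeff_apply]
  exact integral_dual_apply_translate_eq_zero π (unipotentRadicalGL F c) μ hπ (forall_mem_span_unipotentRadicalGL_of_isSupercuspidal' π hπ hsc hc)
    Nj hmono hcpt ho hex φ x y v (hcont.integrable_of_hasCompactSupport hcs)

variable {B : V →ₗ⋆[ℂ] V →ₗ[ℂ] ℂ}

/-- **HAAR READING, GENERAL LABELS, sesquilinear coefficient `c_{B u', u} = π.matrixCoeff (B u') u`** — ★ B4-E1's `hcusp` on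
`↥(unipotentRadicalGL F (![false, false, true] : Fin 3 → Bool))` for `θ = fun g => B u' (π g u)` (definitionally `π.matrixCoeff (B u') u`, ★ `matrixCoeff_apply`): for ANY Haar
`ν` on `↥U_c`, `∀ x y, ∫_{U_c} c_{B u', u}(x u y) dν = 0`. [cite: HarishChandra1970, Part I §3 p. 9] [cite: Casselman1995, Thm. 5.3.1] -/
theorem integral_matrixCoeff_sesqForm_translate_unipotentRadicalGL_eq_zero (hπ : π.IsSmooth) (hsc : π.IsSupercuspidal) (hc : IsProperBlocks c)
    (hcm : Monotone c) [μ.IsHaarMeasure] (hBinv : ∀ (g : GL (Fin n) F) (v w : V), B (π g v) (π g w) = B v w) (x y : GL (Fin n) F) (u u' : V) :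
    ∫ uu, π.matrixCoeff (B u') u (x * (uu : GL (Fin n) F) * y) ∂μ = 0 := by
  haveI := isMulRightInvariant_haar_unipotentRadicalGL (F := F) c hcm μ
  exact integral_matrixCoeff_translate_unipotentRadicalGL_eq_zero π μ hπ hsc hc hcm (Representation.sesqForm_apply_mem_contragredient hπ B hBinv u') u x y

end Labels

/-! ## §3  The opposite radicals `U_{c ∘ rev} = w₀ U_c w₀⁻¹` -/

section Opposite

variable {F : Type*} [Field F] {n : ℕ}

/-- **Entries of `w₀ g w₀⁻¹`**: `(w₀ g w₀⁻¹)ᵢⱼ = g_{rev i, rev j}` for the long Weyl element `w₀ = weylLong n F` (★ `weylLong_eq_permGL`, ★ `permGL_mul_mul_permGL_apply`,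
★ `weylLong_inv`). [folklore] -/
theorem coe_weylLong_conj_apply (g : GL (Fin n) F) (i j : Fin n) :
    ((weylLong n F * g * (weylLong n F)⁻¹ : GL (Fin n) F) : Matrix (Fin n) (Fin n) F) i j = (g : Matrix (Fin n) (Fin n) F) (Fin.rev i) (Fin.rev j) := by
  rw [weylLong_inv, Units.val_mul, Units.val_mul, weylLong_eq_permGL, permGL_mul_mul_permGL_apply, Fin.revPerm_symm, Fin.revPerm_apply, Fin.revPerm_apply]

/-- `w₀ g w₀⁻¹ ∈ U_{c₂}` for `g ∈ U_{c₁}` when `c₂ = c₁ ∘ rev`. [cite: HarishChandra1970, Part VII §2] -/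
theorem weylLong_conj_mem_unipotentRadicalGL {α : Type*} [LinearOrder α] {c₁ c₂ : Fin n → α} (hrev : ∀ i, c₂ i = c₁ (Fin.rev i)) {g : GL (Fin n) F}
    (hg : g ∈ unipotentRadicalGL F c₁) : weylLong n F * g * (weylLong n F)⁻¹ ∈ unipotentRadicalGL F c₂ := by
  rw [mem_unipotentRadicalGL_iff_apply] at hg ⊢
  intro i j hij
  rw [coe_weylLong_conj_apply, hg (Fin.rev i) (Fin.rev j) (by rw [← hrev, ← hrev]; exact hij)]
  by_cases h : i = j
  · subst h; rw [Matrix.one_apply_eq, Matrix.one_apply_eq]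
  · rw [Matrix.one_apply_ne h, Matrix.one_apply_ne (fun h' => h (Fin.rev_injective h'))]

/-- `w₀⁻¹ g w₀ ∈ U_{c₁}` for `g ∈ U_{c₂}` when `c₂ = c₁ ∘ rev` (`rev` is an involution). [cite: HarishChandra1970, Part VII §2] -/
theorem weylLong_inv_conj_mem_unipotentRadicalGL {α : Type*} [LinearOrder α] {c₁ c₂ : Fin n → α} (hrev : ∀ i, c₂ i = c₁ (Fin.rev i)) {g : GL (Fin n) F}
    (hg : g ∈ unipotentRadicalGL F c₂) : (weylLong n F)⁻¹ * g * weylLong n F ∈ unipotentRadicalGL F c₁ := by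
  have h := weylLong_conj_mem_unipotentRadicalGL (F := F) (c₁ := c₂) (c₂ := c₁) (fun i => by rw [hrev, Fin.rev_rev]) hg
  rw [weylLong_inv] at h ⊢
  exact h

variable [ValuativeRel F] [TopologicalSpace F] [IsNonarchimedeanLocalField F]

/-- **`U_{c₁} ≃ₜ* U_{c₂}` BY CONJUGATION WITH THE LONG WEYL ELEMENT**, for any labellings with `c₂ = c₁ ∘ rev` (same label type, so that e.g. `c₁ = ![false, true, true]`,
`c₂ = ![true, true, false] : Fin 3 → Bool` match ★ B4-E1's carriers literally). [cite: HarishChandra1970, Part VII §2] [cite: Rogawski1990, §4.13 p. 70] -/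
theorem exists_continuousMulEquiv_unipotentRadicalGL_conj_weylLong {α : Type*} [LinearOrder α] (c₁ c₂ : Fin n → α) (hrev : ∀ i, c₂ i = c₁ (Fin.rev i)) :
    ∃ e : ↥(unipotentRadicalGL F c₁) ≃ₜ* ↥(unipotentRadicalGL F c₂),
      ∀ u : ↥(unipotentRadicalGL F c₁), ((e u : ↥(unipotentRadicalGL F c₂)) : GL (Fin n) F) = weylLong n F * (u : GL (Fin n) F) * (weylLong n F)⁻¹ := by
  haveI : T2Space F := (isLocalField F).toT2Space
  set f : ↥(unipotentRadicalGL F c₁) → ↥(unipotentRadicalGL F c₂) :=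
    fun u => ⟨weylLong n F * (u : GL (Fin n) F) * (weylLong n F)⁻¹, weylLong_conj_mem_unipotentRadicalGL hrev u.2⟩ with hf
  set g : ↥(unipotentRadicalGL F c₂) → ↥(unipotentRadicalGL F c₁) :=
    fun v => ⟨(weylLong n F)⁻¹ * (v : GL (Fin n) F) * weylLong n F, weylLong_inv_conj_mem_unipotentRadicalGL hrev v.2⟩ with hg
  have hf_coe : ∀ u, ((f u : ↥(unipotentRadicalGL F c₂)) : GL (Fin n) F) = weylLong n F * (u : GL (Fin n) F) * (weylLong n F)⁻¹ := fun u => rfl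
  have hg_coe : ∀ v, ((g v : ↥(unipotentRadicalGL F c₁)) : GL (Fin n) F) = (weylLong n F)⁻¹ * (v : GL (Fin n) F) * weylLong n F := fun v => rfl
  have hgf : Function.LeftInverse g f := fun u => Subtype.ext (by rw [hg_coe, hf_coe]; group)
  have hfg : Function.RightInverse g f := fun v => Subtype.ext (by rw [hf_coe, hg_coe]; group)
  have hmul : ∀ u v, f (u * v) = f u * f v := fun u v => Subtype.ext (by rw [Subgroup.coe_mul, hf_coe, hf_coe, hf_coe, Subgroup.coe_mul]; group)
  have hfc : Continuous f := Continuous.subtype_mk ((continuous_const.mul continuous_subtype_val).mul continuous_const) _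
  have hgc : Continuous g := Continuous.subtype_mk ((continuous_const.mul continuous_subtype_val).mul continuous_const) _
  exact ⟨{ toFun := f, invFun := g, left_inv := hgf, right_inv := hfg, map_mul' := hmul, continuous_toFun := hfc, continuous_invFun := hgc },
    fun u => rfl⟩

variable {V : Type*} [AddCommGroup V] [Module ℂ V] (π : Representation ℂ (GL (Fin n) F) V) [NeZero n] {α : Type*} [LinearOrder α] [Fintype α]
  {c₁ c₂ : Fin n → α} [MeasurableSpace ↥(unipotentRadicalGL F c₂)] [BorelSpace ↥(unipotentRadicalGL F c₂)] (ν : Measure ↥(unipotentRadicalGL F c₂))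
  {B : V →ₗ⋆[ℂ] V →ₗ[ℂ] ℂ}

/-- **CUSP-FORM PROPERTY ALONG THE OPPOSITE RADICAL `U_{c₂} = w₀ U_{c₁} w₀⁻¹`** (`c₁` proper monotone, `c₂ = c₁ ∘ rev` antitone): for `π` smooth supercuspidal, `B` `π`-invariant
and EVERY Haar measure `ν` of `↥U_{c₂}`: `∀ x y u u', ∫_{U_{c₂}} B u' (π(x v y) u) dν(v) = 0` — ★ B4-E1's `hcusp` on `↥(unipotentRadicalGL F ![true, true, false])` VERBATIM
(`c₁ = ![false, true, true]`), and the `hcuspbar` of ★ `CuspFormCancellationCore` ∕ B4-A1 (lower unitriangular: `c₁ = id`, `c₂ = Fin.rev`). §1 transport + §2.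
[cite: HarishChandra1970, Part I §3 p. 9, Part VII §2] [cite: Casselman1995, Thm. 5.3.1] [cite: Rogawski1990, §4.13 p. 70] -/
theorem integral_sesqForm_apply_translate_unipotentRadicalGL_opposite_eq_zero (hπ : π.IsSmooth) (hsc : π.IsSupercuspidal) (hc : IsProperBlocks c₁) (hcm : Monotone c₁)
    (hrev : ∀ i, c₂ i = c₁ (Fin.rev i)) [ν.IsHaarMeasure] (hBinv : ∀ (g : GL (Fin n) F) (v w : V), B (π g v) (π g w) = B v w)
    (x y : GL (Fin n) F) (u u' : V) :
    ∫ vv, B u' (π (x * (vv : GL (Fin n) F) * y) u) ∂ν = 0 := by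
  borelize ↥(unipotentRadicalGL F c₁)
  obtain ⟨e, he⟩ := exists_continuousMulEquiv_unipotentRadicalGL_conj_weylLong (F := F) c₁ c₂ hrev
  exact integral_translate_eq_zero_of_continuousMulEquiv (unipotentRadicalGL F c₁) (unipotentRadicalGL F c₂) (weylLong n F) e he
    (π.matrixCoeff (B u') u) (fun ν₁ hν₁ x' y' => by
      haveI := hν₁
      exact integral_matrixCoeff_sesqForm_translate_unipotentRadicalGL_eq_zero π ν₁ hπ hsc hc hcm hBinv x' y' u u') ν x y

end Opposite

/-! ## §4  The road's pull-back readings `θ̃ = θ ∘ π_Λ` on `GL₃(F)` (general labels; opposite radicals) -/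

section GL3PullBack

variable {F : Type*} [Field F] [ValuativeRel F] [TopologicalSpace F] [IsNonarchimedeanLocalField F] [CharZero F] (Λ₀ : Subgroup Fˣ)
  [(Λ₀.map (Matrix.GeneralLinearGroup.scalar (Fin 3))).Normal] {V : Type*} [AddCommGroup V] [Module ℂ V]
  (ρ : Representation ℂ (GL (Fin 3) F ⧸ Λ₀.map (Matrix.GeneralLinearGroup.scalar (Fin 3))) V) {α : Type*} [LinearOrder α] [Fintype α]
  {B : V →ₗ⋆[ℂ] V →ₗ[ℂ] ℂ}

/-- **PULL-BACK READING, GENERAL LABELS**: for `ρ` smooth supercuspidal on `G_Λ = GL₃(F) ⧸ Λ·1` (any `Λ₀`), `B` `ρ`-invariant, `c : Fin 3 → α` proper monotone (e.g.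
`![false, false, true] : Fin 3 → Bool`), every Haar `ν` on `↥U_c` and all `x y ∈ GL₃(F)`: `∫_{U_c} B u' (ρ(π_Λ(x u y)) u) dν(u) = 0`.
[cite: HarishChandra1970, Part I §3 p. 9, Part VII §3 p. 70] [cite: Casselman1995, Thm. 5.3.1] -/
theorem integral_sesqForm_apply_translate_unipotentRadicalGL_comp_mk_eq_zero' (hρ : ρ.IsSmooth) (hsc : ρ.IsSupercuspidal) {c : Fin 3 → α} (hc : IsProperBlocks c)
    (hcm : Monotone c) [MeasurableSpace ↥(unipotentRadicalGL F c)] [BorelSpace ↥(unipotentRadicalGL F c)] (ν : Measure ↥(unipotentRadicalGL F c)) [ν.IsHaarMeasure]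
    (hBinv : ∀ (g : GL (Fin 3) F ⧸ Λ₀.map (Matrix.GeneralLinearGroup.scalar (Fin 3))) (v w : V), B (ρ g v) (ρ g w) = B v w)
    (x y : GL (Fin 3) F) (u u' : V) :
    ∫ uu, B u' (ρ (QuotientGroup.mk (x * (uu : GL (Fin 3) F) * y)) u) ∂ν = 0 :=
  integral_matrixCoeff_sesqForm_translate_unipotentRadicalGL_eq_zero (ρ.comp (QuotientGroup.mk' (Λ₀.map (Matrix.GeneralLinearGroup.scalar (Fin 3))))) ν
    ((isSmooth_comp_mk'_iff _ ρ).2 hρ) (isSupercuspidal_comp_mk'_quotScalar Λ₀ ρ hsc) hc hcm (fun _ v w => hBinv _ v w) x y u u'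

/-- **PULL-BACK READING, OPPOSITE RADICALS**: the same along `U_{c₂}`, `c₂ = c₁ ∘ rev` with `c₁` proper monotone (e.g. `c₂ = ![true, true, false]`, `c₁ = ![false, true, true]`).
[cite: HarishChandra1970, Part I §3 p. 9, Part VII §2] [cite: Casselman1995, Thm. 5.3.1] -/
theorem integral_sesqForm_apply_translate_unipotentRadicalGL_opposite_comp_mk_eq_zero (hρ : ρ.IsSmooth) (hsc : ρ.IsSupercuspidal) {c₁ c₂ : Fin 3 → α}
    (hc : IsProperBlocks c₁) (hcm : Monotone c₁) (hrev : ∀ i, c₂ i = c₁ (Fin.rev i))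
    [MeasurableSpace ↥(unipotentRadicalGL F c₂)] [BorelSpace ↥(unipotentRadicalGL F c₂)] (ν : Measure ↥(unipotentRadicalGL F c₂)) [ν.IsHaarMeasure]
    (hBinv : ∀ (g : GL (Fin 3) F ⧸ Λ₀.map (Matrix.GeneralLinearGroup.scalar (Fin 3))) (v w : V), B (ρ g v) (ρ g w) = B v w)
    (x y : GL (Fin 3) F) (u u' : V) :
    ∫ vv, B u' (ρ (QuotientGroup.mk (x * (vv : GL (Fin 3) F) * y)) u) ∂ν = 0 :=
  integral_sesqForm_apply_translate_unipotentRadicalGL_opposite_eq_zero (ρ.comp (QuotientGroup.mk' (Λ₀.map (Matrix.GeneralLinearGroup.scalar (Fin 3))))) ν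
    ((isSmooth_comp_mk'_iff _ ρ).2 hρ) (isSupercuspidal_comp_mk'_quotScalar Λ₀ ρ hsc) hc hcm hrev (fun _ v w => hBinv _ v w) x y u u'

end GL3PullBack

end Summit.HodgeConjecture.HodgeConjecture.Cruxes.H413.K2E3GL3SupercuspidalCuspFormOppositeRadicals

end
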